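import Summits.QuantumFields.YangMills.Theorems.FlatTubeReductionCoreTransferMoments
import HarnessLib

/-!
# (C2-moments, step (iii′)) THE CORE TRANSFER DEFECT IN RAW FORM — the input-variable moments appear as COLOUR-AVERAGED REWEIGHTED CENTRAL TRANSFERS
# `Y[Ω̃,W̃] = ∫_c ρ_c·fpFibreTransfer β Ω̃ W̃ (c⁻¹(oT 1 x')c) 1 dc` (no pointwise ratio inputs) — and Cauchy–Schwarz inside the fibre transfer, the two tools of the
# reference-density route (memo `Cruxes/NearFlatRatioLaw/Lines/ratepack-v7-moments-g18.md` §3)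
# (route `FlatTubeReduction`, crux K1 `NearFlatRatioLaw` stmt-QuantumFields-24720, line «ratepack_v2» skeleton v6, stub `stub_hODpot_A`; seat `ym-line-ftr-p1` g18; R2b1 RECORD rung —
# no summit statement is proved here)

WHY.  `…CoreTransferMoments.colour_fpFibreTransfer_defect_le_moments` consumes the reweighted CENTRAL transfers as pointwise RATIOS `w(s')`; a pointwise ratio at output `x''` is a
shifted-Gaussian computation (memo v7 §3, rejected).  The reference-density route instead keeps the reweighted transfers RAW, applies Cauchy–Schwarz in the input variables `(v,g)` at
fixed output (`T[m]² ≤ T[1]·T[m²]`, this file §1) and in the colour, and only then integrates over the OUTPUT, where `∫dπ(x') M(x')e^{−β²‖P_Γx'‖²}·T[m²](R_c x')` is a moment of the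
DIAGONAL reference density `ρ₁` (landed log-free machine `…ReferenceMoments`).
* §1 `sq_integral_mul_le` — weighted Cauchy–Schwarz `(∫Jfg)² ≤ (∫Jf²)(∫Jg²)` for `J ≥ 0` (discriminant); ★ `fpFibreTransfer_weighted_sq_le` — `T[Ω·a, W·b]² ≤ T[Ω,W]·T[Ω·a², W·b²]`;
* §2 ★★★ `colour_fpFibreTransfer_sub_le_raw` — `|∫_c F_c − c_qP(x')ρ̄| ≤ 2(e₀Y[Ω,W] + c₁'(Y[Ω‖·‖²,W] + Y[Ω,W·G]) + 3c₂'(Y[Ω‖·‖⁴,W] + Y[Ω,W·G²])) + η_c c_qP(x')ρ̄`,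
  `e₀ = c₀ + c₁'s' + 3c₂'s'²`, `ρ_c = K₁(c⁻¹u'c,u)/K₁(1,1)`, `ρ̄ = K̃₁(u',u)/K₁(1,1)`, slow windows `(δ, δu, σ)` free (pointwise downstream), majorants `c₀, c₁', c₂'` as in
  `…CoreTransferMoments.abs_transportExponent_le_quad`.  (The squared Cauchy–Schwarz form is the sequel `…CoreTransferMomentsCS`.)
HONEST FRAMING: bookkeeping for a stub of the CONDITIONAL reduction route R2b1 (rate twin); the squared form, the output integration (iv), (ρ2), (C1)-rate, the `L²` assembly, (B-ST)
and the crux remain OPEN; femto rung R2b1 (RECORD label); not infinite volume, not a mass gap, not Clay.  No defs, no named facts, no `sorry`.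
-/
set_option autoImplicit false

noncomputable section

open MeasureTheory Filter Topology Real
open scoped BigOperators
open Literature.MathematicalPhysics.QuantumFieldTheory
open Literature.MathematicalPhysics.QuantumLattice

namespace Summit.QuantumFields.YangMills.Theorems.FemtoTransferGap.TwoLattice.ConstTube

open Summit.QuantumFields.YangMills.Theorems.FemtoTransferGap
open Summit.QuantumFields.YangMills.Theorems.FemtoTransferGap.TwoLattice
open Summit.QuantumFields.YangMills.Theorems.FemtoTransferGap.TwoLattice.Avg
open Summit.QuantumFields.YangMills.Theorems.FemtoTransferGap.TwoLattice.Stiff (LinkSpace)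
open Summit.QuantumFields.YangMills.Theorems.TwistedTraceScaling.Negative.R33 (gaugeTransform_const_orthoTube)

variable {L : ℕ} [NeZero L]

/-! ## §1 Weighted Cauchy–Schwarz -/

/-- Weighted Cauchy–Schwarz: `(∫ J·f·g)² ≤ (∫ J·f²)·(∫ J·g²)` for `J ≥ 0` with the three products integrable. [folklore] -/
theorem sq_integral_mul_le {X : Type*} [MeasurableSpace X] (μ : Measure X) {J f g : X → ℝ} (hJ0 : ∀ x, 0 ≤ J x)
    (hff : Integrable (fun x => J x * f x ^ 2) μ) (hfg : Integrable (fun x => J x * (f x * g x)) μ) (hgg : Integrable (fun x => J x * g x ^ 2) μ) :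
    (∫ x, J x * (f x * g x) ∂μ) ^ 2 ≤ (∫ x, J x * f x ^ 2 ∂μ) * ∫ x, J x * g x ^ 2 ∂μ := by
  set A : ℝ := ∫ x, J x * f x ^ 2 ∂μ with hA
  set B : ℝ := ∫ x, J x * (f x * g x) ∂μ with hB
  set C : ℝ := ∫ x, J x * g x ^ 2 ∂μ with hC
  have hA0 : 0 ≤ A := integral_nonneg fun x => mul_nonneg (hJ0 x) (sq_nonneg _)
  have hC0 : 0 ≤ C := integral_nonneg fun x => mul_nonneg (hJ0 x) (sq_nonneg _)
  have hquad : ∀ t : ℝ, 0 ≤ C - 2 * t * B + t ^ 2 * A := fun t => by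
    have e1 : (fun x => J x * (g x - t * f x) ^ 2) = fun x => (J x * g x ^ 2 - 2 * t * (J x * (f x * g x))) + t ^ 2 * (J x * f x ^ 2) := by funext x; ring
    have h0 : 0 ≤ ∫ x, J x * (g x - t * f x) ^ 2 ∂μ := integral_nonneg fun x => mul_nonneg (hJ0 x) (sq_nonneg _)
    have i1 : Integrable (fun x => 2 * t * (J x * (f x * g x))) μ := hfg.const_mul _
    have i2 : Integrable (fun x => J x * g x ^ 2 - 2 * t * (J x * (f x * g x))) μ := hgg.sub i1
    have i3 : Integrable (fun x => t ^ 2 * (J x * f x ^ 2)) μ := hff.const_mul _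
    rw [e1, integral_add i2 i3, integral_sub hgg i1, integral_const_mul, integral_const_mul] at h0
    linarith
  rcases eq_or_lt_of_le hA0 with hA00 | hApos
  · -- `A = 0`: `J·f² = 0` a.e., hence `J·f·g = 0` a.e. and `B = 0`
    have hae : (fun x => J x * f x ^ 2) =ᵐ[μ] 0 := (integral_eq_zero_iff_of_nonneg (fun x => mul_nonneg (hJ0 x) (sq_nonneg _)) hff).mp hA00.symm
    have hB0 : B = 0 := by
      rw [hB]; refine integral_eq_zero_of_ae ?_
      filter_upwards [hae] with x hx
      have hx' : J x * f x ^ 2 = 0 := hx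
      rcases mul_eq_zero.mp hx' with h | h
      · simp [h]
      · have hf : f x = 0 := pow_eq_zero_iff (n := 2) (by norm_num) |>.mp h
        simp [hf]
    rw [hB0, ← hA00]; simp
  · have h := hquad (B / A)
    have e : C - 2 * (B / A) * B + (B / A) ^ 2 * A = C - B ^ 2 / A := by field_simp; ring
    rw [e] at h
    have h2 : B ^ 2 / A ≤ C := by linarith
    rwa [div_le_iff₀ hApos, mul_comm] at h2

/-- ★ **Cauchy–Schwarz inside the fibre transfer**: `T[Ω·a, W·b](U,u)² ≤ T[Ω,W](U,u)·T[Ω·a², W·b²](U,u)` for `Ω, W ≥ 0` bounded measurable, `0 ≤ a ≤ C_a` on `supp Ω` measurable,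
`0 ≤ b ≤ C_b` measurable. [folklore] -/
theorem fpFibreTransfer_weighted_sq_le (β : ℝ) {Ω : LinkSpace L → ℝ} (hΩm : Measurable Ω) {CΩ : ℝ} (hCΩ : ∀ x, |Ω x| ≤ CΩ) (hΩ0 : ∀ x, 0 ≤ Ω x)
    {W : (Site 3 L → SU2) → ℝ} (hW : Measurable W) {CW : ℝ} (hCW : ∀ g, |W g| ≤ CW) (hW0 : ∀ g, 0 ≤ W g)
    {a : LinkSpace L → ℝ} (ham : Measurable a) (ha0 : ∀ x, 0 ≤ a x) {Ca : ℝ} (hCa : 0 ≤ Ca) (hab : ∀ x, Ω x ≠ 0 → a x ≤ Ca)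
    {b : (Site 3 L → SU2) → ℝ} (hbm : Measurable b) (hb0 : ∀ g, 0 ≤ b g) {Cb : ℝ} (hbb : ∀ g, b g ≤ Cb) (U : GaugeConfig 3 L SU2) (u : GaugeConfig 3 1 SU2) :
    fpFibreTransfer L β (fun x => Ω x * a x) (fun g => W g * b g) U u ^ 2 ≤
      fpFibreTransfer L β Ω W U u * fpFibreTransfer L β (fun x => Ω x * a x ^ 2) (fun g => W g * b g ^ 2) U u := by
  haveI := isFiniteMeasure_orthoTransverse L
  set μP : Measure ((Edge 3 L → Fin 3 → ℝ) × (Site 3 L → SU2)) := (orthoTransverse L).prod (gaugeMeasure L) with hμP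
  set J : (Edge 3 L → Fin 3 → ℝ) × (Site 3 L → SU2) → ℝ := fun p => W p.2 * transferKernel su2Rep β U (gaugeTransform p.2 (orthoTube L u p.1)) * Ω (linkEmbed L p.1) with hJ
  set m : (Edge 3 L → Fin 3 → ℝ) × (Site 3 L → SU2) → ℝ := fun p => a (linkEmbed L p.1) * b p.2 with hm
  have hJmeas : Measurable J := measurable_fpFibreTransfer_integrand β hΩm hW _ _
  obtain ⟨BJ, hBJ⟩ := abs_fpFibreTransfer_integrand_le (L := L) β hCΩ hCW U u
  have hBJ0 : 0 ≤ BJ := (abs_nonneg _).trans (hBJ (0, 1))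
  have hJ0 : ∀ p, 0 ≤ J p := fun p => mul_nonneg (mul_nonneg (hW0 _) (transferKernel_pos su2Rep β _ _).le) (hΩ0 _)
  have hmm : Measurable m := (ham.comp ((measurable_linkEmbed L).comp measurable_fst)).mul (hbm.comp measurable_snd)
  have hm0 : ∀ p, 0 ≤ m p := fun p => mul_nonneg (ha0 _) (hb0 _)
  have hCb0 : 0 ≤ Cb := (hb0 1).trans (hbb 1)
  have hJmk : ∀ k : ℕ, ∀ p, |J p * m p ^ k| ≤ BJ * (Ca * Cb) ^ k := fun k p => by
    by_cases hΩp : Ω (linkEmbed L p.1) = 0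
    · have hJp : J p = 0 := by rw [hJ]; dsimp only; rw [hΩp, mul_zero]
      rw [hJp, zero_mul, abs_zero]; positivity
    · have hmle : m p ≤ Ca * Cb := by rw [hm]; exact mul_le_mul (hab _ hΩp) (hbb _) (hb0 _) hCa
      rw [abs_mul, abs_of_nonneg (pow_nonneg (hm0 p) k)]
      exact mul_le_mul (hBJ p) (pow_le_pow_left₀ (hm0 p) hmle k) (pow_nonneg (hm0 p) k) hBJ0
  have hI1 : Integrable (fun p => J p * (1 : ℝ) ^ 2) μP := by
    simp only [one_pow, mul_one]; exact integrable_of_measurable_abs_le μP hJmeas hBJ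
  have hIm : Integrable (fun p => J p * ((1 : ℝ) * m p)) μP := by
    simp only [one_mul]; exact integrable_of_measurable_abs_le μP (hJmeas.mul hmm) (by simpa only [pow_one] using hJmk 1)
  have hIm2 : Integrable (fun p => J p * m p ^ 2) μP := integrable_of_measurable_abs_le μP (hJmeas.mul (hmm.pow_const 2)) (hJmk 2)
  have hcs := sq_integral_mul_le μP hJ0 hI1 hIm hIm2
  simp only [one_pow, mul_one, one_mul] at hcs
  -- identify the three integrals
  have e1 : ∫ p, J p * m p ∂μP = fpFibreTransfer L β (fun x => Ω x * a x) (fun g => W g * b g) U u := by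
    unfold fpFibreTransfer; refine integral_congr_ae (ae_of_all _ fun p => ?_); rw [hJ, hm]; dsimp only; ring
  have e2 : ∫ p, J p ∂μP = fpFibreTransfer L β Ω W U u := rfl
  have e3 : ∫ p, J p * m p ^ 2 ∂μP = fpFibreTransfer L β (fun x => Ω x * a x ^ 2) (fun g => W g * b g ^ 2) U u := by
    unfold fpFibreTransfer; refine integral_congr_ae (ae_of_all _ fun p => ?_); rw [hJ, hm]; dsimp only; ring
  rw [e1, e2, e3] at hcs
  exact hcs


/-! ## §2 ★★★ The raw first-power form -/

/-- ★★★ **THE CORE TRANSFER DEFECT, RAW FORM** (hypotheses as in `…CoreTransferMoments.colour_fpFibreTransfer_defect_le_moments` without the ratio inputs `hwa`, `hwb`):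
`|∫_c F_c − c_qP(x')ρ̄| ≤ 2·(e₀·Y[Ω,W] + c₁'(Y[Ω‖·‖²,W] + Y[Ω,W·G]) + 3c₂'(Y[Ω‖·‖⁴,W] + Y[Ω,W·G²])) + η_c·c_qP(x')ρ̄`,
`Y[Ω̃,W̃] = ∫_c ρ_c·fpFibreTransfer β Ω̃ W̃ (c⁻¹(oT 1 x')c) 1 dc`, `e₀ = c₀ + c₁'s' + 3c₂'s'²`. [cite: Luscher1983, §3] -/
theorem colour_fpFibreTransfer_sub_le_raw {β : ℝ} (hβ1 : 1 ≤ β) {Ω : LinkSpace L → ℝ} (hΩm : Measurable Ω) {CΩ : ℝ} (hCΩ : ∀ x, |Ω x| ≤ CΩ) (hΩ0 : ∀ x, 0 ≤ Ω x)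
    {W : (Site 3 L → SU2) → ℝ} (hW : Measurable W) {CW : ℝ} (hCW : ∀ g, |W g| ≤ CW) (hW0 : ∀ g, 0 ≤ W g)
    {δ δu T Tc R Rin Γ σ c₀ c₁ c₂ : ℝ} (hδ1 : δ ≤ 1 / 2) (hα1 : δ + δu ≤ 1) (hσ : σ < 2) (hRinT : Rin ≤ Tc)
    (hΩt : ∀ v : Edge 3 L → Fin 3 → ℝ, Ω (linkEmbed L v) ≠ 0 → v ∈ capBalancedSet L ∧ ‖linkEmbed L v‖ ≤ R)
    (hWc : ∀ g : Site 3 L → SU2, W g ≠ 0 → (∀ x, ‖su2Quat (g x) - 1‖ ≤ T) ∧ ‖∑ x, vecPart (g x)‖ ≤ Γ)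
    {P : LinkSpace L → ℝ} (hPinv : ∀ (g : SU2) (x : LinkSpace L), P (adL L g x) = P x) {cq ηc : ℝ}
    (hC1 : ∀ v'' : Edge 3 L → Fin 3 → ℝ, v'' ∈ capBalancedSet L → (∀ (e : Edge 3 L) (a : Fin 3), |v'' e a| ≤ Tc) → ‖linkEmbed L v''‖ ≤ Rin →
      |fpFibreTransfer L β Ω W (orthoTube L 1 v'') 1 - cq * P (linkEmbed L v'')| ≤ ηc * (cq * P (linkEmbed L v'')))
    (hS900 : Rin ^ 2 + R ^ 2 + (Fintype.card (Site 3 L) : ℝ) * T ^ 2 ≤ 1 / 900)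
    (hc₀ : 216 * β * (δ + δu) * δ * Γ ≤ c₀)
    (hc₁ : 300000000 * ((Fintype.card (Edge 3 L) : ℝ) + (Fintype.card (Plaquette 3 L × Fin 3) : ℝ) + (Fintype.card (Plaquette 3 L) : ℝ)) *
      (β * ((δ + δu) + δ + (δ + δu) ^ 2 + δ ^ 2 + Real.sqrt σ) + Real.sqrt β / 2) ≤ c₁)
    (hc₂ : 300000000 * ((Fintype.card (Edge 3 L) : ℝ) + (Fintype.card (Plaquette 3 L × Fin 3) : ℝ) + (Fintype.card (Plaquette 3 L) : ℝ)) * (β + β * Real.sqrt β / 2) ≤ c₂)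
    (hc₀0 : 0 ≤ c₀) (hH1 : c₀ + c₁ * (Rin ^ 2 + R ^ 2 + (Fintype.card (Site 3 L) : ℝ) * T ^ 2) + c₂ * (Rin ^ 2 + R ^ 2 + (Fintype.card (Site 3 L) : ℝ) * T ^ 2) ^ 2 ≤ 1)
    (u' u : GaugeConfig 3 1 SU2) (hu' : ∀ k : Fin 3, ‖su2Quat (u' (0, k)) - 1‖ ≤ δ) (hS' : (L : ℝ) ^ 3 * wilsonAction su2Rep u' ≤ σ)
    (hu : ∀ k : Fin 3, ‖su2Quat (u (0, k)) - 1‖ ≤ δu) (hS : (L : ℝ) ^ 3 * wilsonAction su2Rep u ≤ σ)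
    {v' : Edge 3 L → Fin 3 → ℝ} (hv' : v' ∈ capBalancedSet L) (hx' : ‖linkEmbed L v'‖ ≤ Rin) :
    |∫ c, fpFibreTransfer L β Ω W (gaugeTransform (fun _ : Site 3 L => c⁻¹) (orthoTube L u' v')) u ∂haarProbability SU2 -
        cq * P (linkEmbed L v') * (avgKernel ((L : ℝ) ^ 3 * β) u' u / transferKernel su2Rep ((L : ℝ) ^ 3 * β) (1 : GaugeConfig 3 1 SU2) 1)| ≤
      2 * ((c₀ + c₁ * ‖linkEmbed L v'‖ ^ 2 + 3 * c₂ * (‖linkEmbed L v'‖ ^ 2) ^ 2) *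
              ∫ c, transferKernel su2Rep ((L : ℝ) ^ 3 * β) (gaugeTransform (fun _ : Site 3 1 => c⁻¹) u') u / transferKernel su2Rep ((L : ℝ) ^ 3 * β) (1 : GaugeConfig 3 1 SU2) 1 *
                fpFibreTransfer L β Ω W (gaugeTransform (fun _ : Site 3 L => c⁻¹) (orthoTube L 1 v')) 1 ∂haarProbability SU2 +
            c₁ * (∫ c, transferKernel su2Rep ((L : ℝ) ^ 3 * β) (gaugeTransform (fun _ : Site 3 1 => c⁻¹) u') u / transferKernel su2Rep ((L : ℝ) ^ 3 * β) (1 : GaugeConfig 3 1 SU2) 1 *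
                  fpFibreTransfer L β (fun x => Ω x * (‖x‖ ^ 2) ^ 1) W (gaugeTransform (fun _ : Site 3 L => c⁻¹) (orthoTube L 1 v')) 1 ∂haarProbability SU2 +
                ∫ c, transferKernel su2Rep ((L : ℝ) ^ 3 * β) (gaugeTransform (fun _ : Site 3 1 => c⁻¹) u') u / transferKernel su2Rep ((L : ℝ) ^ 3 * β) (1 : GaugeConfig 3 1 SU2) 1 *
                  fpFibreTransfer L β Ω (fun g => W g * (∑ x, ‖su2Quat (g x) - 1‖ ^ 2) ^ 1) (gaugeTransform (fun _ : Site 3 L => c⁻¹) (orthoTube L 1 v')) 1 ∂haarProbability SU2) +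
            3 * c₂ * (∫ c, transferKernel su2Rep ((L : ℝ) ^ 3 * β) (gaugeTransform (fun _ : Site 3 1 => c⁻¹) u') u / transferKernel su2Rep ((L : ℝ) ^ 3 * β) (1 : GaugeConfig 3 1 SU2) 1 *
                  fpFibreTransfer L β (fun x => Ω x * (‖x‖ ^ 2) ^ 2) W (gaugeTransform (fun _ : Site 3 L => c⁻¹) (orthoTube L 1 v')) 1 ∂haarProbability SU2 +
                ∫ c, transferKernel su2Rep ((L : ℝ) ^ 3 * β) (gaugeTransform (fun _ : Site 3 1 => c⁻¹) u') u / transferKernel su2Rep ((L : ℝ) ^ 3 * β) (1 : GaugeConfig 3 1 SU2) 1 *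
                  fpFibreTransfer L β Ω (fun g => W g * (∑ x, ‖su2Quat (g x) - 1‖ ^ 2) ^ 2) (gaugeTransform (fun _ : Site 3 L => c⁻¹) (orthoTube L 1 v')) 1 ∂haarProbability SU2)) +
        ηc * (cq * P (linkEmbed L v') * (avgKernel ((L : ℝ) ^ 3 * β) u' u / transferKernel su2Rep ((L : ℝ) ^ 3 * β) (1 : GaugeConfig 3 1 SU2) 1)) := by
  haveI : SecondCountableTopology SU2 := secondCountableTopology_su2
  set B : ℝ := (L : ℝ) ^ 3 * β with hB
  have hβ : 0 ≤ β := by linarith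
  set s' : ℝ := ‖linkEmbed L v'‖ ^ 2 with hs'
  set e₀ : ℝ := c₀ + c₁ * s' + 3 * c₂ * s' ^ 2 with he₀
  -- signs
  have hδ0 : 0 ≤ δ := (norm_nonneg _).trans (hu' 0)
  have hδu0 : 0 ≤ δu := (norm_nonneg _).trans (hu 0)
  have hK0 : (0 : ℝ) ≤ 300000000 * ((Fintype.card (Edge 3 L) : ℝ) + (Fintype.card (Plaquette 3 L × Fin 3) : ℝ) + (Fintype.card (Plaquette 3 L) : ℝ)) := by positivity
  have hc₁0 : 0 ≤ c₁ := le_trans (mul_nonneg hK0 (by have := Real.sqrt_nonneg σ; have := Real.sqrt_nonneg β; positivity)) hc₁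
  have hc₂0 : 0 ≤ c₂ := le_trans (mul_nonneg hK0 (by have := Real.sqrt_nonneg β; positivity)) hc₂
  have hK1 : 0 < transferKernel su2Rep B (1 : GaugeConfig 3 1 SU2) 1 := transferKernel_pos _ _ _ _
  -- reweighted data
  have hΩR : ∀ x, Ω x ≠ 0 → ‖x‖ ≤ R := fun x hx => by
    have hxe : linkEmbed L (fun e a => x (e, a)) = x := PiLp.ext fun ea => by simp [linkEmbed_apply]
    have h := (hΩt (fun e a => x (e, a)) (by rwa [hxe])).2
    rwa [hxe] at h
  obtain ⟨ha1m, ha1b, ha10⟩ := reweightedProfile_props hΩm hCΩ hΩ0 hΩR 1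
  obtain ⟨ha2m, ha2b, ha20⟩ := reweightedProfile_props hΩm hCΩ hΩ0 hΩR 2
  obtain ⟨hb1m, hb1b, hb10⟩ := reweightedWeight_props hW hCW hW0 1
  obtain ⟨hb2m, hb2b, hb20⟩ := reweightedWeight_props hW hCW hW0 2
  -- the slow ratio
  set ρ : SU2 → ℝ := fun c => transferKernel su2Rep B (gaugeTransform (fun _ : Site 3 1 => c⁻¹) u') u / transferKernel su2Rep B (1 : GaugeConfig 3 1 SU2) 1 with hρ
  obtain ⟨M1, hM1⟩ := exists_transferKernel_le su2Rep continuous_su2Rep B (L := 1)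
  have hρm : Measurable ρ := by
    have hK : Measurable fun p : GaugeConfig 3 1 SU2 × GaugeConfig 3 1 SU2 => transferKernel su2Rep B p.1 p.2 :=
      (continuous_transferKernel su2Rep continuous_su2Rep B).measurable
    have hc : Measurable fun c : SU2 => gaugeTransform (fun _ : Site 3 1 => c⁻¹) u' := by
      have hcu : Measurable fun _ : SU2 => u' := measurable_const
      have h := (measurable_constGaugeAction (L := 1)).comp (hcu.prodMk measurable_inv)
      simpa only [Function.comp_def] using h
    have hu0 : Measurable fun _ : SU2 => u := measurable_const
    have h := hK.comp (hc.prodMk hu0)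
    exact (by simpa only [Function.comp_def] using h : Measurable fun c : SU2 => transferKernel su2Rep B (gaugeTransform (fun _ : Site 3 1 => c⁻¹) u') u).div_const _
  have hρ0 : ∀ c, 0 ≤ ρ c := fun c => div_nonneg (transferKernel_pos _ _ _ _).le hK1.le
  have hρB : 0 ≤ M1 / transferKernel su2Rep B (1 : GaugeConfig 3 1 SU2) 1 := div_nonneg ((transferKernel_pos su2Rep B (1 : GaugeConfig 3 1 SU2) 1).le.trans (hM1 _ _)) hK1.le
  have hρb : ∀ c, |ρ c| ≤ M1 / transferKernel su2Rep B (1 : GaugeConfig 3 1 SU2) 1 := fun c => by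
    rw [abs_of_nonneg (hρ0 c)]; exact div_le_div_of_nonneg_right (hM1 _ _) hK1.le
  have hρint : Integrable ρ (haarProbability SU2) := integrable_of_measurable_abs_le _ hρm hρb
  have hρI : ∫ c, ρ c ∂haarProbability SU2 = avgKernel B u' u / transferKernel su2Rep B (1 : GaugeConfig 3 1 SU2) 1 := by
    rw [hρ, integral_div, ← avgKernel_one_eq_integral_conj]
  -- the colour integrand and the five central colour functions
  set F : SU2 → ℝ := fun c => fpFibreTransfer L β Ω W (gaugeTransform (fun _ : Site 3 L => c⁻¹) (orthoTube L u' v')) u with hF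
  have hFm : Measurable F := measurable_fpFibreTransfer_conj β hΩm hW _ u
  obtain ⟨BF, hBF⟩ := abs_fpFibreTransfer_le (L := L) β hCΩ hCW u
  have hFint : Integrable F (haarProbability SU2) := integrable_of_measurable_abs_le _ hFm fun c => hBF _
  set T0 : SU2 → ℝ := fun c => fpFibreTransfer L β Ω W (gaugeTransform (fun _ : Site 3 L => c⁻¹) (orthoTube L 1 v')) 1 with hT0
  set Ta1 : SU2 → ℝ := fun c => fpFibreTransfer L β (fun x => Ω x * (‖x‖ ^ 2) ^ 1) W (gaugeTransform (fun _ : Site 3 L => c⁻¹) (orthoTube L 1 v')) 1 with hTa1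
  set Ta2 : SU2 → ℝ := fun c => fpFibreTransfer L β (fun x => Ω x * (‖x‖ ^ 2) ^ 2) W (gaugeTransform (fun _ : Site 3 L => c⁻¹) (orthoTube L 1 v')) 1 with hTa2
  set Tb1 : SU2 → ℝ := fun c => fpFibreTransfer L β Ω (fun g => W g * (∑ x, ‖su2Quat (g x) - 1‖ ^ 2) ^ 1) (gaugeTransform (fun _ : Site 3 L => c⁻¹) (orthoTube L 1 v')) 1 with hTb1
  set Tb2 : SU2 → ℝ := fun c => fpFibreTransfer L β Ω (fun g => W g * (∑ x, ‖su2Quat (g x) - 1‖ ^ 2) ^ 2) (gaugeTransform (fun _ : Site 3 L => c⁻¹) (orthoTube L 1 v')) 1 with hTb2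
  -- integrability of `ρ·T*`
  have hint : ∀ {Ω' : LinkSpace L → ℝ} {W' : (Site 3 L → SU2) → ℝ}, Measurable Ω' → (∃ C', ∀ x, |Ω' x| ≤ C') → Measurable W' → (∃ C', ∀ g, |W' g| ≤ C') →
      Integrable (fun c => ρ c * fpFibreTransfer L β Ω' W' (gaugeTransform (fun _ : Site 3 L => c⁻¹) (orthoTube L 1 v')) 1) (haarProbability SU2) := by
    intro Ω' W' hΩ'm ⟨CΩ', hCΩ'⟩ hW'm ⟨CW', hCW'⟩
    obtain ⟨B', hB'⟩ := abs_fpFibreTransfer_le (L := L) β hCΩ' hCW' (1 : GaugeConfig 3 1 SU2)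
    refine integrable_of_measurable_abs_le _ (hρm.mul (measurable_fpFibreTransfer_conj β hΩ'm hW'm _ 1)) (C := M1 / transferKernel su2Rep B (1 : GaugeConfig 3 1 SU2) 1 * B') fun c => ?_
    rw [abs_mul]
    exact mul_le_mul (hρb c) (hB' _) (abs_nonneg _) hρB
  have hI0 := hint hΩm ⟨CΩ, hCΩ⟩ hW ⟨CW, hCW⟩
  have hIa1 := hint ha1m ⟨_, ha1b⟩ hW ⟨CW, hCW⟩
  have hIa2 := hint ha2m ⟨_, ha2b⟩ hW ⟨CW, hCW⟩
  have hIb1 := hint hΩm ⟨CΩ, hCΩ⟩ hb1m ⟨_, hb1b⟩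
  have hIb2 := hint hΩm ⟨CΩ, hCΩ⟩ hb2m ⟨_, hb2b⟩
  -- support radii
  have hSsupp : ∀ (v'' v : Edge 3 L → Fin 3 → ℝ) (g : Site 3 L → SU2), ‖linkEmbed L v''‖ ≤ Rin → Ω (linkEmbed L v) ≠ 0 → W g ≠ 0 →
      ‖linkEmbed L v''‖ ^ 2 + ‖linkEmbed L v‖ ^ 2 + ∑ x, ‖su2Quat (g x) - 1‖ ^ 2 ≤ Rin ^ 2 + R ^ 2 + (Fintype.card (Site 3 L) : ℝ) * T ^ 2 := by
    intro v'' v g hv'' hΩv hWg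
    have h1 : ‖linkEmbed L v''‖ ^ 2 ≤ Rin ^ 2 := pow_le_pow_left₀ (norm_nonneg _) hv'' 2
    have h2 : ‖linkEmbed L v‖ ^ 2 ≤ R ^ 2 := pow_le_pow_left₀ (norm_nonneg _) (hΩt v hΩv).2 2
    have h3 : ∑ x, ‖su2Quat (g x) - 1‖ ^ 2 ≤ (Fintype.card (Site 3 L) : ℝ) * T ^ 2 := by
      calc ∑ x, ‖su2Quat (g x) - 1‖ ^ 2 ≤ ∑ _x : Site 3 L, T ^ 2 := Finset.sum_le_sum fun x _ => pow_le_pow_left₀ (norm_nonneg _) ((hWc g hWg).1 x) 2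
        _ = (Fintype.card (Site 3 L) : ℝ) * T ^ 2 := by rw [Finset.sum_const, Finset.card_univ, nsmul_eq_mul]
    linarith
  -- the central output point conjugated: `c⁻¹(oT 1 v')c = oT 1 (R_{c⁻¹} v')`
  have hone : ∀ c : SU2, gaugeTransform (fun _ : Site 3 1 => c⁻¹) (1 : GaugeConfig 3 1 SU2) = 1 := fun c => by
    funext e; show c⁻¹ * 1 * c⁻¹⁻¹ = 1; group
  have hcentral : ∀ (c : SU2) (Ω' : LinkSpace L → ℝ) (W' : (Site 3 L → SU2) → ℝ),
      fpFibreTransfer L β Ω' W' (gaugeTransform (fun _ : Site 3 L => c⁻¹) (orthoTube L 1 v')) 1 = fpFibreTransfer L β Ω' W' (orthoTube L 1 (colourRotate L (fun _ => c⁻¹) v')) 1 := by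
    intro c Ω' W'
    rw [fpFibreTransfer_conj_orthoTube β Ω' W' c 1 1 hv', hone]
  -- pointwise in the colour
  have hpt : ∀ c : SU2, |F c - ρ c * (cq * P (linkEmbed L v'))| ≤
      2 * ρ c * (e₀ * T0 c + c₁ * (Ta1 c + Tb1 c) + 3 * c₂ * (Ta2 c + Tb2 c)) + ρ c * (ηc * (cq * P (linkEmbed L v'))) := by
    intro c
    set u'' : GaugeConfig 3 1 SU2 := gaugeTransform (fun _ : Site 3 1 => c⁻¹) u' with hu''
    set v'' : Edge 3 L → Fin 3 → ℝ := colourRotate L (fun _ => c⁻¹) v' with hv''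
    have hFc : F c = fpFibreTransfer L β Ω W (orthoTube L u'' v'') u := by rw [hF]; exact fpFibreTransfer_conj_orthoTube β Ω W c u' u hv'
    have hu''δ : ∀ k : Fin 3, ‖su2Quat (u'' (0, k)) - 1‖ ≤ δ := fun k => by
      rw [hu'']
      show ‖su2Quat (c⁻¹ * u' (0, k) * c⁻¹⁻¹) - 1‖ ≤ δ
      rw [norm_su2Quat_conj_sub_one]; exact hu' k
    have hα : ∀ k : Fin 3, ‖su2Quat (u'' (0, k)) - su2Quat (u (0, k))‖ ≤ δ + δu := fun k => by
      calc ‖su2Quat (u'' (0, k)) - su2Quat (u (0, k))‖ = ‖(su2Quat (u'' (0, k)) - 1) + (1 - su2Quat (u (0, k)))‖ := by congr 1; abel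
        _ ≤ ‖su2Quat (u'' (0, k)) - 1‖ + ‖1 - su2Quat (u (0, k))‖ := norm_add_le _ _
        _ ≤ δ + δu := add_le_add (hu''δ k) (by rw [norm_sub_rev]; exact hu k)
    have hS'' : (L : ℝ) ^ 3 * wilsonAction su2Rep u'' ≤ σ := by rw [hu'', wilsonAction_gaugeTransform]; exact hS'
    have hv''cap : v'' ∈ capBalancedSet L := colourRotate_mem_capBalancedSet L hv'
    have hx'' : linkEmbed L v'' = adL L c⁻¹ (linkEmbed L v') := by rw [hv'']; exact linkEmbed_colourRotate_const c⁻¹ v'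
    have hnx'' : ‖linkEmbed L v''‖ = ‖linkEmbed L v'‖ := by rw [hx'', LinearIsometryEquiv.norm_map]
    have hx''Rin : ‖linkEmbed L v''‖ ≤ Rin := by rw [hnx'']; exact hx'
    have hPx : P (linkEmbed L v'') = P (linkEmbed L v') := by rw [hx'', hPinv]
    have hsx : ‖linkEmbed L v''‖ ^ 2 = s' := by rw [hnx'']
    have hv''T : ∀ (e : Edge 3 L) (a : Fin 3), |v'' e a| ≤ Tc := fun e a => by
      have h := PiLp.norm_apply_le (linkEmbed L v'') (e, a)
      rw [Real.norm_eq_abs, linkEmbed_apply] at h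
      exact h.trans (hx''Rin.trans hRinT)
    have hX : ∀ (v : Edge 3 L → Fin 3 → ℝ) (g : Site 3 L → SU2), Ω (linkEmbed L v) ≠ 0 → W g ≠ 0 →
        |offX L β u'' u v'' v g + diagX L β u'' v'' v g| ≤
            c₀ + c₁ * (‖linkEmbed L v''‖ ^ 2 + ‖linkEmbed L v‖ ^ 2 + ∑ x, ‖su2Quat (g x) - 1‖ ^ 2) +
              c₂ * (‖linkEmbed L v''‖ ^ 2 + ‖linkEmbed L v‖ ^ 2 + ∑ x, ‖su2Quat (g x) - 1‖ ^ 2) ^ 2 ∧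
          c₀ + c₁ * (‖linkEmbed L v''‖ ^ 2 + ‖linkEmbed L v‖ ^ 2 + ∑ x, ‖su2Quat (g x) - 1‖ ^ 2) +
              c₂ * (‖linkEmbed L v''‖ ^ 2 + ‖linkEmbed L v‖ ^ 2 + ∑ x, ‖su2Quat (g x) - 1‖ ^ 2) ^ 2 ≤ 1 := by
      intro v g hΩv hWg
      have hSle := hSsupp v'' v g hx''Rin hΩv hWg
      have hS0 : 0 ≤ ‖linkEmbed L v''‖ ^ 2 + ‖linkEmbed L v‖ ^ 2 + ∑ x, ‖su2Quat (g x) - 1‖ ^ 2 := by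
        have : 0 ≤ ∑ x, ‖su2Quat (g x) - 1‖ ^ 2 := Finset.sum_nonneg fun _ _ => sq_nonneg _
        positivity
      refine ⟨abs_transportExponent_le_quad hβ1 u'' u hv''cap (hΩt v hΩv).1 hu''δ hδ1 hα hα1 hσ hS'' hS (hWc g hWg).2 le_rfl (hSle.trans hS900) hc₀ hc₁ hc₂, ?_⟩
      have hm1 := mul_le_mul_of_nonneg_left hSle hc₁0
      have hm2 := mul_le_mul_of_nonneg_left (pow_le_pow_left₀ hS0 hSle 2) hc₂0
      linarith
    have hmt := fpFibreTransfer_sub_central_le_moments β hΩm hCΩ hΩ0 hΩR hW hCW hW0 u u'' v'' hc₀0 hc₁0 hc₂0 hX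
    have hρc : transferKernel su2Rep ((L : ℝ) ^ 3 * β) u'' u / transferKernel su2Rep ((L : ℝ) ^ 3 * β) (1 : GaugeConfig 3 1 SU2) 1 = ρ c := by rw [hρ, hB]
    rw [hρc, hsx] at hmt
    -- identify the central transfers at `oT 1 v''` with the colour functions
    have e0 : fpFibreTransfer L β Ω W (orthoTube L 1 v'') 1 = T0 c := by rw [hT0]; exact (hcentral c Ω W).symm
    have ea1 : fpFibreTransfer L β (fun x => Ω x * (‖x‖ ^ 2) ^ 1) W (orthoTube L 1 v'') 1 = Ta1 c := by rw [hTa1]; exact (hcentral c _ _).symm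
    have ea2 : fpFibreTransfer L β (fun x => Ω x * (‖x‖ ^ 2) ^ 2) W (orthoTube L 1 v'') 1 = Ta2 c := by rw [hTa2]; exact (hcentral c _ _).symm
    have eb1 : fpFibreTransfer L β Ω (fun g => W g * (∑ x, ‖su2Quat (g x) - 1‖ ^ 2) ^ 1) (orthoTube L 1 v'') 1 = Tb1 c := by rw [hTb1]; exact (hcentral c _ _).symm
    have eb2 : fpFibreTransfer L β Ω (fun g => W g * (∑ x, ‖su2Quat (g x) - 1‖ ^ 2) ^ 2) (orthoTube L 1 v'') 1 = Tb2 c := by rw [hTb2]; exact (hcentral c _ _).symm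
    rw [e0, ea1, ea2, eb1, eb2] at hmt
    have hq := abs_le.mp (hC1 v'' hv''cap hv''T hx''Rin)
    rw [hPx, e0] at hq
    have h2 : |ρ c * T0 c - ρ c * (cq * P (linkEmbed L v'))| ≤ ρ c * (ηc * (cq * P (linkEmbed L v'))) := by
      rw [← mul_sub, abs_mul, abs_of_nonneg (hρ0 c)]
      exact mul_le_mul_of_nonneg_left (abs_le.mpr ⟨by linarith [hq.1], by linarith [hq.2]⟩) (hρ0 c)
    rw [hFc]
    calc |fpFibreTransfer L β Ω W (orthoTube L u'' v'') u - ρ c * (cq * P (linkEmbed L v'))|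
        = |(fpFibreTransfer L β Ω W (orthoTube L u'' v'') u - ρ c * T0 c) + (ρ c * T0 c - ρ c * (cq * P (linkEmbed L v')))| := by ring_nf
      _ ≤ |fpFibreTransfer L β Ω W (orthoTube L u'' v'') u - ρ c * T0 c| + |ρ c * T0 c - ρ c * (cq * P (linkEmbed L v'))| := abs_add_le _ _
      _ ≤ 2 * ρ c * (e₀ * T0 c + c₁ * (Ta1 c + Tb1 c) + 3 * c₂ * (Ta2 c + Tb2 c)) + ρ c * (ηc * (cq * P (linkEmbed L v'))) := add_le_add hmt h2
  -- integrate over the colour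
  have hFdef : ∫ c, fpFibreTransfer L β Ω W (gaugeTransform (fun _ : Site 3 L => c⁻¹) (orthoTube L u' v')) u ∂haarProbability SU2 = ∫ c, F c ∂haarProbability SU2 := rfl
  have hdiff : ∫ c, F c ∂haarProbability SU2 - cq * P (linkEmbed L v') * (avgKernel B u' u / transferKernel su2Rep B (1 : GaugeConfig 3 1 SU2) 1) =
      ∫ c, (F c - cq * P (linkEmbed L v') * ρ c) ∂haarProbability SU2 := by
    rw [← hρI, ← integral_const_mul, integral_sub hFint (hρint.const_mul _)]
  -- integrability of the pieces, in the exact lambda shapes used below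
  have k0 : Integrable (fun c => e₀ * (ρ c * T0 c)) (haarProbability SU2) := hI0.const_mul e₀
  have k1s : Integrable (fun c => ρ c * Ta1 c + ρ c * Tb1 c) (haarProbability SU2) := hIa1.add hIb1
  have k1 : Integrable (fun c => c₁ * (ρ c * Ta1 c + ρ c * Tb1 c)) (haarProbability SU2) := k1s.const_mul c₁
  have k2s : Integrable (fun c => ρ c * Ta2 c + ρ c * Tb2 c) (haarProbability SU2) := hIa2.add hIb2
  have k2 : Integrable (fun c => 3 * c₂ * (ρ c * Ta2 c + ρ c * Tb2 c)) (haarProbability SU2) := k2s.const_mul (3 * c₂)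
  have k01 : Integrable (fun c => e₀ * (ρ c * T0 c) + c₁ * (ρ c * Ta1 c + ρ c * Tb1 c)) (haarProbability SU2) := k0.add k1
  have k012 : Integrable (fun c => e₀ * (ρ c * T0 c) + c₁ * (ρ c * Ta1 c + ρ c * Tb1 c) + 3 * c₂ * (ρ c * Ta2 c + ρ c * Tb2 c)) (haarProbability SU2) := k01.add k2
  have kA : Integrable (fun c => 2 * (e₀ * (ρ c * T0 c) + c₁ * (ρ c * Ta1 c + ρ c * Tb1 c) + 3 * c₂ * (ρ c * Ta2 c + ρ c * Tb2 c))) (haarProbability SU2) := k012.const_mul 2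
  have kB : Integrable (fun c => ηc * (cq * P (linkEmbed L v')) * ρ c) (haarProbability SU2) := hρint.const_mul _
  have hG : Integrable (fun c => 2 * (e₀ * (ρ c * T0 c) + c₁ * (ρ c * Ta1 c + ρ c * Tb1 c) + 3 * c₂ * (ρ c * Ta2 c + ρ c * Tb2 c)) + ηc * (cq * P (linkEmbed L v')) * ρ c)
      (haarProbability SU2) := kA.add kB
  -- the integral of the majorant
  have i1 : ∫ c, (ρ c * Ta1 c + ρ c * Tb1 c) ∂haarProbability SU2 = (∫ c, ρ c * Ta1 c ∂haarProbability SU2) + ∫ c, ρ c * Tb1 c ∂haarProbability SU2 := integral_add hIa1 hIb1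
  have i2 : ∫ c, (ρ c * Ta2 c + ρ c * Tb2 c) ∂haarProbability SU2 = (∫ c, ρ c * Ta2 c ∂haarProbability SU2) + ∫ c, ρ c * Tb2 c ∂haarProbability SU2 := integral_add hIa2 hIb2
  have i01 : ∫ c, (e₀ * (ρ c * T0 c) + c₁ * (ρ c * Ta1 c + ρ c * Tb1 c)) ∂haarProbability SU2 =
      (∫ c, e₀ * (ρ c * T0 c) ∂haarProbability SU2) + ∫ c, c₁ * (ρ c * Ta1 c + ρ c * Tb1 c) ∂haarProbability SU2 := integral_add k0 k1
  have i012 : ∫ c, (e₀ * (ρ c * T0 c) + c₁ * (ρ c * Ta1 c + ρ c * Tb1 c) + 3 * c₂ * (ρ c * Ta2 c + ρ c * Tb2 c)) ∂haarProbability SU2 =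
      (∫ c, (e₀ * (ρ c * T0 c) + c₁ * (ρ c * Ta1 c + ρ c * Tb1 c)) ∂haarProbability SU2) + ∫ c, 3 * c₂ * (ρ c * Ta2 c + ρ c * Tb2 c) ∂haarProbability SU2 :=
    integral_add k01 k2
  have iAB : ∫ c, (2 * (e₀ * (ρ c * T0 c) + c₁ * (ρ c * Ta1 c + ρ c * Tb1 c) + 3 * c₂ * (ρ c * Ta2 c + ρ c * Tb2 c)) + ηc * (cq * P (linkEmbed L v')) * ρ c) ∂haarProbability SU2 =
      (∫ c, 2 * (e₀ * (ρ c * T0 c) + c₁ * (ρ c * Ta1 c + ρ c * Tb1 c) + 3 * c₂ * (ρ c * Ta2 c + ρ c * Tb2 c)) ∂haarProbability SU2) +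
        ∫ c, ηc * (cq * P (linkEmbed L v')) * ρ c ∂haarProbability SU2 := integral_add kA kB
  have hmaj : ∫ c, (2 * (e₀ * (ρ c * T0 c) + c₁ * (ρ c * Ta1 c + ρ c * Tb1 c) + 3 * c₂ * (ρ c * Ta2 c + ρ c * Tb2 c)) + ηc * (cq * P (linkEmbed L v')) * ρ c) ∂haarProbability SU2 =
      2 * (e₀ * ∫ c, ρ c * T0 c ∂haarProbability SU2 + c₁ * (∫ c, ρ c * Ta1 c ∂haarProbability SU2 + ∫ c, ρ c * Tb1 c ∂haarProbability SU2) +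
          3 * c₂ * (∫ c, ρ c * Ta2 c ∂haarProbability SU2 + ∫ c, ρ c * Tb2 c ∂haarProbability SU2)) +
        ηc * (cq * P (linkEmbed L v') * (avgKernel B u' u / transferKernel su2Rep B (1 : GaugeConfig 3 1 SU2) 1)) := by
    rw [iAB, integral_const_mul, integral_const_mul, i012, i01, integral_const_mul, integral_const_mul, integral_const_mul, i1, i2, hρI]; ring
  rw [hFdef, hdiff]
  calc |∫ c, (F c - cq * P (linkEmbed L v') * ρ c) ∂haarProbability SU2| ≤ ∫ c, |F c - cq * P (linkEmbed L v') * ρ c| ∂haarProbability SU2 := abs_integral_le_integral_abs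
    _ ≤ ∫ c, (2 * (e₀ * (ρ c * T0 c) + c₁ * (ρ c * Ta1 c + ρ c * Tb1 c) + 3 * c₂ * (ρ c * Ta2 c + ρ c * Tb2 c)) + ηc * (cq * P (linkEmbed L v')) * ρ c) ∂haarProbability SU2 :=
        integral_mono_of_nonneg (ae_of_all _ fun _ => abs_nonneg _) hG (ae_of_all _ fun c => by
          have h := hpt c
          have e : 2 * ρ c * (e₀ * T0 c + c₁ * (Ta1 c + Tb1 c) + 3 * c₂ * (Ta2 c + Tb2 c)) + ρ c * (ηc * (cq * P (linkEmbed L v'))) =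
              2 * (e₀ * (ρ c * T0 c) + c₁ * (ρ c * Ta1 c + ρ c * Tb1 c) + 3 * c₂ * (ρ c * Ta2 c + ρ c * Tb2 c)) + ηc * (cq * P (linkEmbed L v')) * ρ c := by ring
          rwa [show ρ c * (cq * P (linkEmbed L v')) = cq * P (linkEmbed L v') * ρ c by ring, e] at h)
    _ = _ := hmaj

end Summit.QuantumFields.YangMills.Theorems.FemtoTransferGap.TwoLattice.ConstTube

end
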